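import Summits.CriticalPhenomena.PercolationContinuityZ3.Theorems.PercAnnulusCrossingOSSSBlock
import HarnessLib

/-!
# RSW3 lane (lead, gen 19): OSSS FOR CROSSINGS, II — Kesten's box crossings `boxCross L i` with hyperplane seeds:
# `(L_i + 1)·P(1−P) ≤ 4p(1−p)·S_{L_i+1}(p)·E_p[N_piv(boxCross L i)]`

builds on p205010 (kernel theorem, internal audit signed; external expert review pending) — NOT used in this file (every `p`, every `d`).

Cell `prim-rsw3` (LANE 3), lead seat, gen 19.  Support file (`--supports stmt-CriticalPhenomena-4575`); no definitions, no named facts,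
no sorries.  The block `B = {0..L} = Finset.Icc 0 L ⊆ ℤ^d` is read on the box cube of `Λ(N)`, `N ≥ max_j L_j` (`HutchcroftVolumeBoxCube`:
all pairs of `Λ(N)` as coordinates, bias `p` on lattice edges), with the BLOCK incidence (a lattice edge of `Λ(N)` is an edge of the explored
graph iff both endpoints lie in `B`; written in the statements as a lambda, this file declaring no definitions and no notation) and the HYPERPLANE seed sets
`H_s = {v ∈ B : v_i = s}`, `0 ≤ s ≤ L_i`, each of which every open crossing of `B` in direction `i` must meet.

* (part IIa, `…OSSSBlock.lean`: the block incidence, block paths = lattice paths in `B`, the event identity `boxCross L i = {H_0 ↔ H_{L_i}}`, the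
  probability and pivotality bridges.)
* §2 `hyperplane_separates` (discrete intermediate values of the `i`-th coordinate along a block path); `seedProb_hyperplane_le`
  (exploring the clusters of `H_s` reveals a pair `{a,b}` with probability `≤ θ_{|a_i−s|} + θ_{|b_i−s|}`: an open path from `a` to the hyperplane at
  `i`-distance `m` leaves `a + Λ_{m−1}`); `sum_range_natAbs_sub_le` (`Σ_{s=0}^{ℓ} θ_{|α−s|} ≤ 2 S_{ℓ+1}` for `0 ≤ α ≤ ℓ`).
* §3 **`boxCross_variance_le`** — `(L_i⁺ + 1)·P(1−P) ≤ 4·S_{L_i⁺+1}(p)·p(1−p)·Σ_{z ⊆ Λ(N)} P_p(z ∈ E(ℤ^d), z pivotal for boxCross L i)` (every `d`,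
  `L ≤ N` coordinatewise, `p ∈ [0,1]`; `L_i⁺ = max(L_i, 0)`); **`exists_hasDerivAt_boxCrossProb_ge_osss`** / **`…_osss'`** — with Russo:
  `D = E_p[N_piv] ≥ 0` and **`(L_i⁺ + 1)·P_p(1−P_p) ≤ 4p(1−p)·S_{L_i⁺+1}(p)·D ≤ S_{L_i⁺+1}(p)·D`** at every `0 < p < 1` — NO band condition.
  For the cube `{0..n}³`: `E_p[N_piv] ≥ (n+1)·Π_p(n)(1−Π_p(n))/S_{n+1}(p)`.

References: O'Donnell–Saks–Schramm–Servedio, FOCS 2005; Duminil-Copin–Raoufi–Tassion, Ann. of Math. 189 (2019) §3; Dewan–Muirhead, PTRF (2022)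
Lemma 2.9 (explorations from hyperplanes determine crossing events); Kesten, *Percolation theory for mathematicians* (1982) §3.3; Russo (1981).
-/

noncomputable section

namespace Summit.CriticalPhenomena.PercolationContinuityZ3.Theorems.Crossing

open MeasureTheory Finset Function
open Literature.Probability.Percolation Literature.Probability.LatticeModels
open Literature.Probability.ODonnellSaksSchrammServedio2005
open Literature.Probability.ODonnellSaksSchrammServedio2005.Strategy
open Literature.Probability.Percolation.GhostExploration Literature.Probability.Percolation.SeedExploration
open Literature.Probability.Percolation.OneArmOSSS Literature.Probability.Percolation.DCT16
open Summit.CriticalPhenomena.PercolationContinuityZ3.Theorems.SurfaceTension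
open Summit.CriticalPhenomena.PercolationContinuityZ3.Theorems.CrossingRevealment

variable {d : ℕ} (L : Site d) (i : Fin d) (N : ℕ)

/-! ## §2 The hyperplanes: separation and revealment -/

/-- **THE HYPERPLANES SEPARATE** (`0 ≤ s ≤ L_i`): every open block path from the face `H_0` to the face `H_{L_i}` passes through
`H_s = {v ∈ {0..L} : v_i = s}` — the `i`-th coordinate moves by at most one per lattice step — in the form "a vertex of `H_s` is joined to both
ends". [cite: DewanMuirhead2022, §2 proof of Lemma 2.9 (any crossing of the block intersects the hyperplane)]
[cite: DuminilCopinRaoufiTassion2019, §3 proof of Lemma 3.2 (T determines the event)] -/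
theorem hyperplane_separates {s : ℤ} (hs0 : 0 ≤ s) (hsL : s ≤ ((L i).toNat : ℤ)) (y : PairIdx d N → Bool) (a b : BoxV d N)
    (ha : a ∈ {v : BoxV d N | v.1 ∈ Icc 0 L ∧ v.1 i = 0}) (hb : b ∈ {v : BoxV d N | v.1 ∈ Icc 0 L ∧ v.1 i = L i}) (hab : YReach
        (fun a b : BoxV d N => if a.1 ∈ Icc 0 L ∧ b.1 ∈ Icc 0 L then latEdge d N a b else none) y a b) :
    ∃ u ∈ {v : BoxV d N | v.1 ∈ Icc 0 L ∧ v.1 i = s}, YReach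
        (fun a b : BoxV d N => if a.1 ∈ Icc 0 L ∧ b.1 ∈ Icc 0 L then latEdge d N a b else none) y u a ∧ YReach
        (fun a b : BoxV d N => if a.1 ∈ Icc 0 L ∧ b.1 ∈ Icc 0 L then latEdge d N a b else none) y u b := by
  obtain ⟨haB, ha0⟩ := ha
  obtain ⟨hbB, hbL⟩ := hb
  have hLi : 0 ≤ L i := by
    have h := (Finset.mem_Icc.1 haB).2 i
    have h' := (Finset.mem_Icc.1 haB).1 i
    simp only [Pi.zero_apply] at h'
    linarith
  have hsL' : s ≤ L i := by rw [Int.toNat_of_nonneg hLi] at hsL; exact hsL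
  have key : ∀ w : BoxV d N, YReach (fun a b : BoxV d N => if a.1 ∈ Icc 0 L ∧ b.1 ∈ Icc 0 L then latEdge d N a b else none) y a w →
      w.1 i < s ∨ ∃ v ∈ {v : BoxV d N | v.1 ∈ Icc 0 L ∧ v.1 i = s}, YReach
          (fun a b : BoxV d N => if a.1 ∈ Icc 0 L ∧ b.1 ∈ Icc 0 L then latEdge d N a b else none) y a v ∧ YReach
          (fun a b : BoxV d N => if a.1 ∈ Icc 0 L ∧ b.1 ∈ Icc 0 L then latEdge d N a b else none) y v w := by
    intro w hw
    unfold YReach at hw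
    induction hw with
    | refl =>
      by_cases hs : s = 0
      · exact Or.inr ⟨a, ⟨haB, by rw [ha0, hs]⟩, Relation.ReflTransGen.refl, Relation.ReflTransGen.refl⟩
      · exact Or.inl (by rw [ha0]; omega)
    | @tail v w hv hvw ih =>
      rcases ih with hlt | ⟨x, hx, hax, hxv⟩
      · obtain ⟨⟨_, hwB⟩, _, hadj, _⟩ := (yAdj_blockEdge_iff L N).1 hvw |>.imp_right (fun h => yAdj_latEdge_iff.1 h)
        have hstep : w.1 i ≤ v.1 i + 1 := by have := (SurfaceTension.coord_sub_le_one_of_adj hadj i).2; linarith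
        by_cases hwlt : w.1 i < s
        · exact Or.inl hwlt
        · refine Or.inr ⟨w, ⟨hwB, by omega⟩, Relation.ReflTransGen.tail hv hvw, Relation.ReflTransGen.refl⟩
      · exact Or.inr ⟨x, hx, hax, Relation.ReflTransGen.tail hxv hvw⟩
  rcases key b hab with hlt | ⟨v, hv, hav, hvb⟩
  · exact absurd hlt (by rw [hbL]; omega)
  · exact ⟨v, hv, yReach_symm (blockEdge_symm L N) hav, hvb⟩

/-- **THE REVEALMENT BRIDGE**: exploring the clusters of the hyperplane `H_s` reveals the vertex `a` only if `a` is joined to `H_s` by an open block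
path, which leaves the box of radius `|a_i − s| − 1` around `a`: `P_p(a ↔ H_s in the block) ≤ θ_{|a_i − s|}(p)` (translation invariance
`DCT16.real_armEvent`). [cite: DuminilCopinRaoufiTassion2019, §3 proof of Lemma 3.2 (μ[u ↔ ∂Λ_k] ≤ μ[u ↔ ∂Λ_{|k−d(u,0)|}(u)])]
[cite: DewanMuirhead2022, §2 Lemma 2.9 (Rev(e) ≤ P_p[e ↔ hyperplane])] -/
theorem seedProb_hyperplane_le (p : unitInterval) (s : ℤ) (a : BoxV d N) :
    seedProb (fun a b : BoxV d N => if a.1 ∈ Icc 0 L ∧ b.1 ∈ Icc 0 L then latEdge d N a b else none) (boxBias d N p)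
        {v : BoxV d N | v.1 ∈ Icc 0 L ∧ v.1 i = s} a ≤ (bondPercolation (zdGraph d) p).real (siteToBoundary d (a.1 i - s).natAbs) := by
  classical
  unfold seedProb
  rw [← real_setOf_toCube N p (fun x => SeedConn (fun a b : BoxV d N => if a.1 ∈ Icc 0 L ∧ b.1 ∈ Icc 0 L then latEdge d N a b else none)
      {v : BoxV d N | v.1 ∈ Icc 0 L ∧ v.1 i = s} x a), ← real_armEvent p a.1 (a.1 i - s).natAbs]
  refine real_mono_of_forall_subset_edgeSet (zdGraph d) p fun ω hω h => ?_
  obtain ⟨u, ⟨huB, hus⟩, hua⟩ := h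
  have haB : a.1 ∈ Finset.Icc (0 : Site d) L := mem_block_of_yReach L N hua huB
  have hau : YReach
      (fun a b : BoxV d N => if a.1 ∈ Icc 0 L ∧ b.1 ∈ Icc 0 L then latEdge d N a b else none) (toCube N ω) a u := yReach_symm (blockEdge_symm L N) hua
  have hpath := pathIn_block_of_yReach L N hau haB
  refine armEvent_of_pathIn hω hpath (not_mem_box_or_mem_innerBoundary (Fin.pos i) ?_)
  have h1 := natAbs_le_boxNorm (u.1 - a.1) i
  have h2 : (u.1 - a.1) i = -(a.1 i - s) := by simp [hus]
  rw [h2, Int.natAbs_neg] at h1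
  exact h1

/-- For an antitone `f ≥ 0` and `0 ≤ α ≤ ℓ`: `Σ_{s=0}^{ℓ} f(|α − s|) ≤ 2·Σ_{j ≤ ℓ} f(j)` (shift by one and `OneArmOSSS.sum_Icc_dist_le`).
[cite: DuminilCopinRaoufiTassion2019, §3 proof of Lemma 3.2 (Σ_k μ[u ↔ ∂Λ_{|k−d(u,0)|}(u)] ≤ 2S_n)] -/
theorem sum_range_natAbs_sub_le (f : ℕ → ℝ) (hf : Antitone f) (hf0 : ∀ j, 0 ≤ f j) {α : ℤ} {ℓ : ℕ} (hα0 : 0 ≤ α) (hαℓ : α ≤ ℓ) :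
    ∑ s ∈ Finset.range (ℓ + 1), f (α - (s : ℤ)).natAbs ≤ 2 * ∑ j ∈ Finset.range (ℓ + 1), f j := by
  obtain ⟨t, rfl⟩ : ∃ t : ℕ, α = t := ⟨α.toNat, (Int.toNat_of_nonneg hα0).symm⟩
  have htℓ : t ≤ ℓ := by exact_mod_cast hαℓ
  have hre : ∑ s ∈ Finset.range (ℓ + 1), f ((t : ℤ) - (s : ℤ)).natAbs = ∑ k ∈ Finset.Icc 1 (ℓ + 1), f (Nat.dist k (t + 1)) := by
    have himg : Finset.Icc 1 (ℓ + 1) = (Finset.range (ℓ + 1)).image (fun s => s + 1) := by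
      ext k; simp only [Finset.mem_Icc, Finset.mem_range, Finset.mem_image]
      constructor
      · intro hk; exact ⟨k - 1, by omega, by omega⟩
      · rintro ⟨s, hs, rfl⟩; omega
    rw [himg, Finset.sum_image (fun a _ b _ h => by simpa using h)]
    refine Finset.sum_congr rfl fun s _ => ?_
    congr 1
    unfold Nat.dist; omega
  rw [hre]
  exact sum_Icc_dist_le f hf hf0 (by omega : t + 1 ≤ ℓ + 1)

/-! ## §3 The OSSS inequality for `boxCross L i` -/

/-- **THE OSSS VARIANCE INEQUALITY FOR KESTEN'S BOX CROSSINGS** (sum form; every `d`, every `L` with `{0..L} ⊆ Λ(N)`, every `i`, `p ∈ [0,1]`):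
`(L_i⁺ + 1)·P(1−P) ≤ 4·S_{L_i⁺+1}(p)·p(1−p)·Σ_{z ⊆ Λ(N)} P_p(z ∈ E(ℤ^d), z pivotal for boxCross L i)`, `P = P_p(boxCross L i)`, `L_i⁺ = max(L_i,0)`,
`S_m(p) = Σ_{j<m} π_p(j)` — the set-source OSSS inequality (`variance_le_sum_revealment_mul_pivCross`) for each of the `L_i⁺ + 1` hyperplanes `H_s`,
`0 ≤ s ≤ L_i⁺`, summed; a pair `{a,b}` of the block is revealed by the `s`-th tree with probability `≤ θ_{|a_i−s|} + θ_{|b_i−s|}`, whose sum over `s`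
is `≤ 4 S_{L_i⁺+1}`. [cite: DuminilCopinRaoufiTassion2019, §3 Lemma 3.2 and eq. (3.2) (Σ_e Cov ≥ n·f(1−f)/(c S_n))] -/
theorem boxCross_variance_le (hLN : Finset.Icc (0 : Site d) L ⊆ box d N) (p : unitInterval) :
    (((L i).toNat + 1 : ℕ) : ℝ) * (boxCrossProb d p L i * (1 - boxCrossProb d p L i))
      ≤ 4 * (∑ j ∈ Finset.range ((L i).toNat + 1), oneArmProb d p j) * ((p : ℝ) * (1 - p))
          * ∑ z ∈ (box d N).sym2, (bondPercolation (zdGraph d) p).real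
              {ω | z ∈ (zdGraph d).edgeSet ∧ IsPivotal (boxCross L i) z ω} := by
  classical
  set ℓ : ℕ := (L i).toNat with hℓ
  set P : ℝ := boxCrossProb d p L i with hPdef
  set S : ℝ := ∑ j ∈ Finset.range (ℓ + 1), oneArmProb d p j with hS
  set θ : ℕ → ℝ := fun j => (bondPercolation (zdGraph d) p).real (siteToBoundary d j) with hθ
  set c : PairIdx d N → ℝ := fun e => boxBias d N p e * (1 - boxBias d N p e) * pivCross
      (fun a b : BoxV d N => if a.1 ∈ Icc 0 L ∧ b.1 ∈ Icc 0 L then latEdge d N a b else none) (boxBias d N p)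
      {v : BoxV d N | v.1 ∈ Icc 0 L ∧ v.1 i = 0} {v : BoxV d N | v.1 ∈ Icc 0 L ∧ v.1 i = L i} e with hc
  have hc0 : ∀ e, 0 ≤ c e := fun e =>
    mul_nonneg (mul_nonneg (boxBias_nonneg N p.2.1 e) (by linarith [boxBias_le_one N p.2.2 e]))
      (pivCross_nonneg (boxBias_nonneg N p.2.1) (boxBias_le_one N p.2.2) _ _ e)
  -- the revealment majorant of the `s`-th hyperplane: `[a, b ∈ B]·(θ_{|a_i−s|} + θ_{|b_i−s|})`
  set R : ℕ → PairIdx d N → ℝ := fun s e => Sym2.lift ⟨fun a b : Site d =>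
      (if a ∈ Finset.Icc (0 : Site d) L then (1 : ℝ) else 0) * (if b ∈ Finset.Icc (0 : Site d) L then (1 : ℝ) else 0)
        * (θ (a i - (s : ℤ)).natAbs + θ (b i - (s : ℤ)).natAbs),
      fun a b => by ring⟩ e.1 with hR
  have hθ0 : ∀ j, 0 ≤ θ j := fun j => measureReal_nonneg
  have hR0 : ∀ s e, 0 ≤ R s e := by
    intro s e
    obtain ⟨z, hz⟩ := e
    induction z using Sym2.ind with
    | h a b =>
      simp only [hR, Sym2.lift_mk]
      exact mul_nonneg (mul_nonneg (by split_ifs <;> norm_num) (by split_ifs <;> norm_num)) (add_nonneg (hθ0 _) (hθ0 _))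
  -- ONE HYPERPLANE
  have hone : ∀ s ∈ Finset.range (ℓ + 1), P - P ^ 2 ≤ ∑ e, R s e * c e := by
    intro s hs
    rw [Finset.mem_range] at hs
    have h := variance_le_sum_revealment_mul_pivCross (edge :=
        (fun a b : BoxV d N => if a.1 ∈ Icc 0 L ∧ b.1 ∈ Icc 0 L then latEdge d N a b else none)) (blockEdge_symm L N) (blockEdge_ends L N)
      (boxBias d N p) (boxBias_nonneg N p.2.1) (boxBias_le_one N p.2.2)
      (Z := {v : BoxV d N | v.1 ∈ Icc 0 L ∧ v.1 i = (s : ℤ)}) (X := {v : BoxV d N | v.1 ∈ Icc 0 L ∧ v.1 i = 0}) (B :=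
          {v : BoxV d N | v.1 ∈ Icc 0 L ∧ v.1 i = L i})
      (fun y a b ha hb hab => hyperplane_separates L i N (s := (s : ℤ)) (by positivity) (by rw [← hℓ]; exact_mod_cast (by omega : s ≤ ℓ)) y a b ha hb hab)
      (R := R s) (hR0 s) (fun e a b hab => by
        obtain ⟨⟨haB, hbB⟩, he⟩ := (blockEdge_eq_some_iff L N).1 hab
        obtain ⟨_, he'⟩ := latEdge_eq_some_iff.1 he
        simp only [hR, he', Sym2.lift_mk, if_pos haB, if_pos hbB, one_mul]
        exact add_le_add (seedProb_hyperplane_le L i N p s a) (seedProb_hyperplane_le L i N p s b))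
    rw [sum_wt_gcross_hyperplanes_eq L i N hLN p] at h
    simpa only [hc, mul_assoc] using h
  -- sum over the `ℓ + 1` hyperplanes
  have hsum : ∑ s ∈ Finset.range (ℓ + 1), (P - P ^ 2) ≤ ∑ s ∈ Finset.range (ℓ + 1), ∑ e, R s e * c e :=
    Finset.sum_le_sum hone
  rw [Finset.sum_const, Finset.card_range, nsmul_eq_mul, Finset.sum_comm] at hsum
  -- the summed revealment majorant is `≤ 4 S`
  have hrev : ∑ e, ∑ s ∈ Finset.range (ℓ + 1), R s e * c e ≤ ∑ e, 4 * S * c e := by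
    refine Finset.sum_le_sum fun e _ => ?_
    rw [← Finset.sum_mul]
    refine mul_le_mul_of_nonneg_right ?_ (hc0 e)
    have hS' : S = ∑ j ∈ Finset.range (ℓ + 1), θ j := rfl
    obtain ⟨z, hz⟩ := e
    induction z using Sym2.ind with
    | h a b =>
      simp only [hR, Sym2.lift_mk]
      by_cases hab : a ∈ Finset.Icc (0 : Site d) L ∧ b ∈ Finset.Icc (0 : Site d) L
      · simp only [if_pos hab.1, if_pos hab.2, one_mul]
        rw [Finset.sum_add_distrib]
        have hanti : Antitone θ := antitone_real_siteToBoundary (d := d) p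
        have hLi : 0 ≤ L i := by
          have h := (Finset.mem_Icc.1 hab.1).2 i
          have h' := (Finset.mem_Icc.1 hab.1).1 i
          simp only [Pi.zero_apply] at h'
          linarith
        have hℓ' : ((ℓ : ℕ) : ℤ) = L i := by rw [hℓ]; exact Int.toNat_of_nonneg hLi
        have ha0 : 0 ≤ a i := by have := (Finset.mem_Icc.1 hab.1).1 i; simpa using this
        have haℓ : a i ≤ ℓ := by rw [hℓ']; exact (Finset.mem_Icc.1 hab.1).2 i
        have hb0 : 0 ≤ b i := by have := (Finset.mem_Icc.1 hab.2).1 i; simpa using this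
        have hbℓ : b i ≤ ℓ := by rw [hℓ']; exact (Finset.mem_Icc.1 hab.2).2 i
        have hA := sum_range_natAbs_sub_le θ hanti hθ0 ha0 haℓ
        have hB := sum_range_natAbs_sub_le θ hanti hθ0 hb0 hbℓ
        rw [hS']
        linarith
      · have : 0 ≤ S := Finset.sum_nonneg fun j _ => measureReal_nonneg
        rcases not_and_or.1 hab with h | h
        · simp only [if_neg h, zero_mul, Finset.sum_const_zero]; linarith
        · simp only [if_neg h, mul_zero, zero_mul, Finset.sum_const_zero]; linarith
  -- identify `Σ_e c_e` with `p(1−p)` times Russo's sum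
  have hcs : ∑ e, 4 * S * c e = 4 * S * ((p : ℝ) * (1 - p))
      * ∑ z ∈ (box d N).sym2, (bondPercolation (zdGraph d) p).real {ω | z ∈ (zdGraph d).edgeSet ∧ IsPivotal (boxCross L i) z ω} := by
    rw [← Finset.mul_sum]
    simp only [hc, bias_mul_pivCross_hyperplanes_eq L i N hLN]
    rw [← Finset.mul_sum, ← Finset.sum_coe_sort (box d N).sym2]
    ring
  have hfin := hsum.trans (hrev.trans (le_of_eq hcs))
  have : (((ℓ + 1 : ℕ)) : ℝ) * (P * (1 - P)) = ((ℓ + 1 : ℕ) : ℝ) * (P - P ^ 2) := by ring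
  rw [this]
  push_cast at hfin ⊢
  exact hfin


/-- The block `{0..L}` lies in the box `Λ(N)` for `N = max_j L_j⁺`. [folklore] -/
theorem Icc_subset_box_sup (L : Site d) : Finset.Icc (0 : Site d) L ⊆ box d (Finset.univ.sup fun j => (L j).toNat) := by
  intro x hx
  rw [Finset.mem_Icc] at hx
  rw [mem_box]
  intro j
  have h0 : (0 : Site d) j ≤ x j := hx.1 j
  have h1 : x j ≤ L j := hx.2 j
  simp only [Pi.zero_apply] at h0
  have h2 : (L j).toNat ≤ Finset.univ.sup fun j => (L j).toNat := Finset.le_sup (f := fun j => (L j).toNat) (Finset.mem_univ j)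
  have h3 : L j ≤ ((L j).toNat : ℤ) := Int.self_le_toNat (L j)
  constructor
  · linarith
  · calc x j ≤ ((L j).toNat : ℤ) := h1.trans h3
      _ ≤ _ := by exact_mod_cast h2

/-- **THE OSSS DIFFERENTIAL INEQUALITY FOR KESTEN'S BOX CROSSINGS** (every `d`, `L`, `i`, `0 < p < 1`): `q ↦ P_q(boxCross L i)` has at `p` the
derivative `D = E_p[N_piv] ≥ 0` (Russo's formula, over the pairs of a box `Λ(N) ⊇ {0..L}`), and
**`(L_i⁺ + 1)·P_p(1 − P_p) ≤ 4p(1−p)·S_{L_i⁺+1}(p)·D`**, `S_m(p) = Σ_{j<m} π_p(j)` — NO band condition (compare gen 18's Talagrand–Russo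
`exists_hasDerivAt_boxCrossProb_ge`).  For the cube `{0..n}³` of `ℤ³`: `E_p[N_piv] ≥ (n+1)·Π_p(n)(1−Π_p(n))/(4p(1−p)·S_{n+1}(p))`.
[cite: DuminilCopinRaoufiTassion2019, §3 proof of Thm 1.2 eqs. (3.2)–(3.4)] [cite: RussoZW1981, §4 Lemma 3 (4.2)] [cite: Kesten1982, §3.3 (3.32)] -/
theorem exists_hasDerivAt_boxCrossProb_ge_osss (L : Site d) (i : Fin d) {p : ℝ} (hp : p ∈ Set.Ioo (0 : ℝ) 1) :
    ∃ D : ℝ, HasDerivAt (fun q : ℝ => boxCrossProb d (Set.projIcc (0 : ℝ) 1 zero_le_one q) L i) D p ∧ 0 ≤ D ∧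
      ((((L i).toNat + 1 : ℕ)) : ℝ) * (boxCrossProb d (Set.projIcc (0 : ℝ) 1 zero_le_one p) L i
          * (1 - boxCrossProb d (Set.projIcc (0 : ℝ) 1 zero_le_one p) L i))
        ≤ 4 * (p * (1 - p)) * (∑ j ∈ Finset.range ((L i).toNat + 1), oneArmProb d (Set.projIcc (0 : ℝ) 1 zero_le_one p) j) * D := by
  classical
  set N : ℕ := Finset.univ.sup fun j => (L j).toNat with hN
  have hLN : Finset.Icc (0 : Site d) L ⊆ box d N := Icc_subset_box_sup L
  have hpI : p ∈ Set.Icc (0 : ℝ) 1 := ⟨hp.1.le, hp.2.le⟩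
  have hproj : Set.projIcc 0 1 zero_le_one p = ⟨p, hpI⟩ := Set.projIcc_of_mem _ hpI
  have hF : DeterminedBy (boxCross L i) (↑((box d N).sym2) : Set (Sym2 (Site d))) :=
    (determinedBy_boxCross_sym2 L i).mono fun e he => Finset.mem_coe.2 (Finset.sym2_mono hLN (Finset.mem_coe.1 he))
  refine ⟨_, russo_formula_sum_holds (zdGraph d) (isUpperSet_boxCross L i) ((box d N).sym2) hF p hp,
    Finset.sum_nonneg fun _ _ => measureReal_nonneg, ?_⟩
  rw [hproj]
  have h := boxCross_variance_le L i N hLN ⟨p, hpI⟩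
  calc ((((L i).toNat + 1 : ℕ)) : ℝ) * (boxCrossProb d ⟨p, hpI⟩ L i * (1 - boxCrossProb d ⟨p, hpI⟩ L i))
      ≤ 4 * (∑ j ∈ Finset.range ((L i).toNat + 1), oneArmProb d ⟨p, hpI⟩ j) * ((p : ℝ) * (1 - p))
          * ∑ z ∈ (box d N).sym2, (bondPercolation (zdGraph d) ⟨p, hpI⟩).real
              {ω | z ∈ (zdGraph d).edgeSet ∧ IsPivotal (boxCross L i) z ω} := h
    _ = _ := by ring

/-- **Short form** (`4p(1−p) ≤ 1`): **`(L_i⁺ + 1)·P_p(1−P_p) ≤ S_{L_i⁺+1}(p)·E_p[N_piv(boxCross L i)]`** at every `0 < p < 1`, every `d`, `L`, `i`.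
[cite: DuminilCopinRaoufiTassion2019, §3 proof of Thm 1.2 eq. (3.4)] -/
theorem exists_hasDerivAt_boxCrossProb_ge_osss' (L : Site d) (i : Fin d) {p : ℝ} (hp : p ∈ Set.Ioo (0 : ℝ) 1) :
    ∃ D : ℝ, HasDerivAt (fun q : ℝ => boxCrossProb d (Set.projIcc (0 : ℝ) 1 zero_le_one q) L i) D p ∧ 0 ≤ D ∧
      ((((L i).toNat + 1 : ℕ)) : ℝ) * (boxCrossProb d (Set.projIcc (0 : ℝ) 1 zero_le_one p) L i
          * (1 - boxCrossProb d (Set.projIcc (0 : ℝ) 1 zero_le_one p) L i))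
        ≤ (∑ j ∈ Finset.range ((L i).toNat + 1), oneArmProb d (Set.projIcc (0 : ℝ) 1 zero_le_one p) j) * D := by
  obtain ⟨D, hD, hD0, h⟩ := exists_hasDerivAt_boxCrossProb_ge_osss L i hp
  refine ⟨D, hD, hD0, h.trans ?_⟩
  have hS0 : 0 ≤ ∑ j ∈ Finset.range ((L i).toNat + 1), oneArmProb d (Set.projIcc (0 : ℝ) 1 zero_le_one p) j :=
    Finset.sum_nonneg fun _ _ => measureReal_nonneg
  have h4 : 4 * (p * (1 - p)) ≤ 1 := by nlinarith [sq_nonneg (2 * p - 1)]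
  nlinarith [mul_nonneg hS0 hD0]

end Summit.CriticalPhenomena.PercolationContinuityZ3.Theorems.Crossing

end
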